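import Summits.AtomisticToContinuum.FouriersLaw.Theorems.JunctionLocalityNonBallisticStubDrudeFromTruncationRegularAux3
import Summits.AtomisticToContinuum.FouriersLaw.Theorems.EmbeddedDrudeMourreGreenKuboContinuationRegularMixing
import Literature.MathematicalPhysics.KineticTheory.InfiniteChainGibbsInvariance
import Literature.MathematicalPhysics.KineticTheory.InfiniteChainShiftInvariantUniqueness
import Literature.MathematicalPhysics.KineticTheory.InfiniteChainFlowNormalForm
import Literature.MathematicalPhysics.KineticTheory.InfiniteChainInvariantStates
import Literature.MathematicalPhysics.KineticTheory.InfiniteChainSuperstableDynamics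

/-!
# Stub `stub_drudeFromTruncationRegular` (DFT′) of line `drude-controls-conductance` (R3b) — crux
`JunctionLocality.NonBallistic` (stmt-AtomisticToContinuum-9127)

Helper file (`--supports stmt-AtomisticToContinuum-9127`); nothing here closes the item.

`CurrentTiltQuench.DrudeFromTruncation` (stmt-AtomisticToContinuum-11032) RESTRICTED to regular dynamics
(`D.carrier ⊆ 𝒳₀`): for the infinite pinned anharmonic chain `pinnedChain ω₂ lam β γ` (`ω₂, lam, β > 0`),
a shift-invariant, momentum-reversal-invariant DLR state `μ` at `T > 0` and a `μ`-preserving dynamics `D`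
with carrier inside Buttà–Marchioro's good set `𝒳₀`, vanishing of all TRUNCATED Drude weights (the
`NoTruncatedDrude` body: the Cesàro means of `Cov_μ(clip_M(j₀) ∘ φ_t, Σ_{|x| ≤ L} clip_M(j_x))` are
eventually small) implies ZERO DRUDE WEIGHT: `τ⁻¹∫₀^τ C_∞(t) dt → 0`,
`C_∞(t) = D.currentCorrelation μ t = Σ_x ∫ j₀ (j_x ∘ φ_t) dμ`.

Proof (parts 1–3 in the three `…Aux` files):
1. Transfer to the normal form `D'` of the Buttà–Marchioro dynamics (carrier `= 𝒳₀`, identity off `𝒳₀`):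
   `D.flow t = D'.flow t` `μ`-a.e. by uniqueness of solutions inside `𝒳₀`, so the hypothesis and the
   conclusion are the same for `D` and `D'`.
2. `μ` is superstable (`hasSuperstabilityEstimate_of_isShiftInvariant_pinnedChain`) and exponentially
   `ρ`-mixing (`exists_regular_state_mixing_pinnedChain` + uniqueness of the shift-invariant DLR state).
3. For each `M > 0`, Doyon's `ℋ₀` with generators `{j₀, h₀, a_M}`, `a_M = clip_M ∘ j₀`, has a strongly
   continuous Koopman group (part 2); in it `C_∞(t) = ⟪[j₀], U_t[j₀]⟫₀` and
   `Σ_x Cov(a_M, a_M ∘ φ_t ∘ τ_x) = ⟪[a_M], U_t[a_M]⟫₀`.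
4. The hypothesis passes to `L → ∞` at fixed `τ` (part 2, dominated convergence), so the Cesàro means of
   `⟪[a_M], U_t[a_M]⟫₀` are eventually `≤ η` for every `η > 0`: by von Neumann / Suzuki
   (`Mazur.tendsto_inv_mul_integral_inner`) `ℙ[a_M] = 0`, hence the Cesàro means of `C_∞` converge to
   `‖ℙ[j₀]‖² ≤ ‖[j₀] - [a_M]‖₀² = Σ_x Cov(r_M, r_M ∘ τ_x) ≤ K ∫ r_M² ≤ K E[j₀⁴] / M²`
   (`r_M = j₀ - a_M`, `|r_M| ≤ j₀²/M`; `K` from the mixing constants only).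
5. The Cesàro limit is one fixed number `d ≥ 0` with `d ≤ K E[j₀⁴]/M²` for every `M > 0`, so `d = 0`.
-/

noncomputable section

namespace Summit.AtomisticToContinuum.FouriersLaw.Theorems.NonBallistic.DrudeFromTruncation

open MeasureTheory ProbabilityTheory Filter Topology Set Function
open scoped NNReal ENNReal InnerProductSpace
open Literature.MathematicalPhysics.KineticTheory
open Literature.MathematicalPhysics.KineticTheory.HeatConduction

/-- **The Cesàro limit of `C_∞` exists and is `O(M⁻²)`-small**, for the normal form `D` of a
`𝒳₀`-dynamics of the pinned chain preserving the shift- and reversal-invariant DLR state `μ` at `T > 0`,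
given the `NoTruncatedDrude` body for `D`: there are `K, E` such that for every `M > 0` the Cesàro means
`τ⁻¹∫₀^τ C_∞` converge to some `d ∈ [0, K E / M²]` (steps 2–4 of the file header). [folklore] -/
theorem exists_cesaro_currentCorrelation_limit_le {ω₂ lam β : ℝ} (γ : ℝ) (hω : 0 < ω₂) (hl : 0 < lam)
    (hβ : 0 < β) {T : ℝ} (hT : 0 < T) {μ : Measure ChainConfig}
    (hG : (pinnedChain ω₂ lam β γ).IsChainGibbsMeasure T μ) (hS : IsShiftInvariant μ)
    (hR : μ.map (fun σ : ChainConfig => fun x : ℤ => ((σ x).1, -(σ x).2)) = μ)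
    (D : InfiniteChainDynamics (pinnedChain ω₂ lam β γ)) (hcar : D.carrier = (pinnedChain ω₂ lam β γ).bmGood)
    (hid : ∀ (t : ℝ) (σ : ChainConfig), σ ∉ (pinnedChain ω₂ lam β γ).bmGood → D.flow t σ = σ)
    (hD : D.PreservesMeasure μ)
    (hH : ∀ M : ℝ, 0 < M → ∀ η : ℝ, 0 < η → ∃ τ₀ : ℝ, ∀ τ : ℝ, τ₀ ≤ τ → ∃ L₀ : ℕ, ∀ L : ℕ, L₀ ≤ L →
      |τ⁻¹ * ∫ t in (0:ℝ)..τ,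
        ((∫ σ, max (-M) (min M ((pinnedChain ω₂ lam β γ).bondCurrentZ (D.flow t σ) 0)) *
            (∑ x ∈ Finset.Icc (-(L : ℤ)) (L : ℤ),
              max (-M) (min M ((pinnedChain ω₂ lam β γ).bondCurrentZ σ x))) ∂μ) -
          (∫ σ, max (-M) (min M ((pinnedChain ω₂ lam β γ).bondCurrentZ (D.flow t σ) 0)) ∂μ) *
            (∫ σ, ∑ x ∈ Finset.Icc (-(L : ℤ)) (L : ℤ),
              max (-M) (min M ((pinnedChain ω₂ lam β γ).bondCurrentZ σ x)) ∂μ))| ≤ η) :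
    ∃ K E : ℝ, ∀ M : ℝ, 0 < M → ∃ d : ℝ, 0 ≤ d ∧ d ≤ K * E / M ^ 2 ∧
      Tendsto (fun τ : ℝ => τ⁻¹ * ∫ t in (0:ℝ)..τ, D.currentCorrelation μ t) atTop (𝓝 d) := by
  -- the chain data
  have hU1 : OscillatorChain.IsEvenPolyOfDegree (pinnedChain ω₂ lam β γ).U 2 :=
    OscillatorChain.pinnedChain_isEvenPolyOfDegree_U β γ hω.le hl
  have hV1 : OscillatorChain.IsEvenPolyOfDegree (pinnedChain ω₂ lam β γ).V 2 :=
    OscillatorChain.pinnedChain_isEvenPolyOfDegree_V ω₂ lam γ hβ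
  have hU0 : ∀ r, 0 ≤ (pinnedChain ω₂ lam β γ).U r := hU1.choose_spec.2.2
  have hUm : Measurable (pinnedChain ω₂ lam β γ).U := hU1.contDiff_two.continuous.measurable
  -- superstability and mixing of `μ`
  have hss : (pinnedChain ω₂ lam β γ).HasSuperstabilityEstimate μ :=
    OscillatorChain.hasSuperstabilityEstimate_of_isShiftInvariant_pinnedChain γ hω hl.le hβ.le hT hG hS
  haveI : IsProbabilityMeasure μ := hss.1
  obtain ⟨μ', hG', hS', -, C, m, hm, hmix⟩ :=
    GreenKuboContinuation.TemperatureBlindVitaliHurwitz.exists_regular_state_mixing_pinnedChain γ hω hl.le hβ.le hT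
  have hμμ' : μ' = μ :=
    OscillatorChain.eq_of_isChainGibbsMeasure_of_isShiftInvariant_pinnedChain γ hω hl.le hβ.le hT hG' hS' hG hS
  subst hμμ'
  have hmix' : ∀ (a : ℤ) (n : ℕ) (f g : ChainConfig → ℝ),
      DependsOn f {i : ℤ | i ≤ a} → DependsOn g {i : ℤ | a + n ≤ i} → Measurable f → Measurable g →
      MemLp f 2 μ' → MemLp g 2 μ' →
      |∫ σ, f σ * g σ ∂μ' - (∫ σ, f σ ∂μ') * ∫ σ, g σ ∂μ'| ≤
        max C 0 * Real.exp (-(m * n)) * (∫ σ, f σ ^ 2 ∂μ') ^ (1 / 2 : ℝ) *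
          (∫ σ, g σ ^ 2 ∂μ') ^ (1 / 2 : ℝ) := by
    intro a n f g h1 h2 h3 h4 h5 h6
    refine (hmix a n f g h1 h2 h3 h4 h5 h6).trans ?_
    have hA : 0 ≤ (∫ σ, f σ ^ 2 ∂μ') ^ (1 / 2 : ℝ) :=
      Real.rpow_nonneg (integral_nonneg fun _ => sq_nonneg _) _
    have hB : 0 ≤ (∫ σ, g σ ^ 2 ∂μ') ^ (1 / 2 : ℝ) :=
      Real.rpow_nonneg (integral_nonneg fun _ => sq_nonneg _) _
    have hE : 0 ≤ Real.exp (-(m * n)) := Real.exp_nonneg _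
    have : C * Real.exp (-(m * n)) ≤ max C 0 * Real.exp (-(m * n)) :=
      mul_le_mul_of_nonneg_right (le_max_left _ _) hE
    exact mul_le_mul_of_nonneg_right (mul_le_mul_of_nonneg_right this hA) hB
  have hC : 0 ≤ max C 0 := le_max_right _ _
  have hτ : ∀ x : ℤ, MeasurePreserving (chainShift x) μ' μ' := hS.measurePreserving_chainShift
  -- the constants
  obtain ⟨K, hK0, hK⟩ := exists_tsum_abs_cov_self_le_of_mixing hτ hC hm hmix'
  have hj4 : Integrable (fun σ => (pinnedChain ω₂ lam β γ).bondCurrentZ σ 0 ^ 4) μ' :=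
    hss.integrable_bondCurrentZ_pow_four (by norm_num) hU0 hUm hV1 0
  refine ⟨K, ∫ σ, (pinnedChain ω₂ lam β γ).bondCurrentZ σ 0 ^ 4 ∂μ', fun M hM => ?_⟩
  -- Doyon's `ℋ₀` with the clipped current
  obtain ⟨Z, hZμ, haZ, hcont⟩ := exists_zeroWavenumberData_clipCurrent (by norm_num) (by norm_num) hU1 hV1 D
    hcar hid hG hS hss hD hC hm hmix' hM
  subst hZμ
  have hjZ : (fun σ => (pinnedChain ω₂ lam β γ).bondCurrentZ σ 0) ∈ Z.localObs := Z.bondCurrent_mem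
  have hRZ : Z.μ.map momentumReversalZ = Z.μ := by rw [coe_momentumReversalZ]; exact hR
  have hmean : ∫ σ, (pinnedChain ω₂ lam β γ).bondCurrentZ σ 0 ∂Z.μ = 0 :=
    integral_bondCurrentZ_eq_zero_of_map_momentumReversalZ_eq _ hRZ 0
  -- the Cesàro means of `⟪[a_M], U_t [a_M]⟫₀` are eventually small
  have hces : ∀ η : ℝ, 0 < η → ∃ τ₀ : ℝ, ∀ τ : ℝ, τ₀ ≤ τ →
      |τ⁻¹ * ∫ t in (0 : ℝ)..τ,
        ⟪Z.fluct (fun σ => max (-M) (min M ((pinnedChain ω₂ lam β γ).bondCurrentZ σ 0))),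
          Z.koopman t (Z.fluct (fun σ => max (-M) (min M ((pinnedChain ω₂ lam β γ).bondCurrentZ σ 0))))⟫_ℝ| ≤
        η := by
    intro η hη
    obtain ⟨τ₀, hτ₀⟩ := cesaro_tsum_cov_clipCurrent_le (by norm_num) (by norm_num) hU1 hV1 D hcar hid hG hS
      hss hD hC hm hmix' hM (hH M hM η hη)
    refine ⟨τ₀, fun τ hτle => ?_⟩
    have e : ∀ t : ℝ,
        ⟪Z.fluct (fun σ => max (-M) (min M ((pinnedChain ω₂ lam β γ).bondCurrentZ σ 0))),
          Z.koopman t (Z.fluct (fun σ => max (-M) (min M ((pinnedChain ω₂ lam β γ).bondCurrentZ σ 0))))⟫_ℝ =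
        ∑' x : ℤ, cov[(fun σ : ChainConfig => max (-M) (min M ((pinnedChain ω₂ lam β γ).bondCurrentZ σ 0))),
          ((fun σ : ChainConfig => max (-M) (min M ((pinnedChain ω₂ lam β γ).bondCurrentZ σ 0))) ∘ D.flow t) ∘
            chainShift x; Z.μ] := fun t =>
      (Z.toFluctuationDynamics.inner_fluct_koopman_fluct t haZ haZ).trans
        (Z.form_eq_tsum haZ (Z.comp_flow_mem t haZ))
    rw [intervalIntegral.integral_congr fun t _ => e t]
    exact hτ₀ τ hτle
  -- so `ℙ [a_M] = 0`, and the Cesàro means of `C_∞ = ⟪[j₀], U_t [j₀]⟫₀` converge to `d ≤ ‖[j₀] - [a_M]‖²`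
  have hPφ := hydroProjection_eq_zero_of_cesaro_le Z.toFluctuationDynamics hcont _ hces
  obtain ⟨d, hd0, hdle, hd⟩ := tendsto_cesaro_inner_koopman_le Z.toFluctuationDynamics hcont Z.currentClass _ hPφ
  refine ⟨d, hd0, hdle.trans ?_, ?_⟩
  · -- `‖[j₀] - [a_M]‖² = ⟨r, r⟩₀ ≤ K ∫ r² ≤ K E / M²`
    have hrZ := Z.localObs.sub_mem hjZ haZ
    have hrm : Measurable ((fun σ => (pinnedChain ω₂ lam β γ).bondCurrentZ σ 0) -
        fun σ => max (-M) (min M ((pinnedChain ω₂ lam β γ).bondCurrentZ σ 0))) :=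
      (measurable_bondCurrentZ _ 0).sub (measurable_clipCurrent _ M 0)
    have hrd : DependsOn ((fun σ => (pinnedChain ω₂ lam β γ).bondCurrentZ σ 0) -
        fun σ => max (-M) (min M ((pinnedChain ω₂ lam β γ).bondCurrentZ σ 0))) (Icc (-1 : ℤ) 1) := by
      intro σ σ' h
      have e1 : (pinnedChain ω₂ lam β γ).bondCurrentZ σ 0 = (pinnedChain ω₂ lam β γ).bondCurrentZ σ' 0 :=
        (pinnedChain ω₂ lam β γ).dependsOn_bondCurrentZ_zero h
      simp only [Pi.sub_apply, e1]
    have hr2 : MemLp ((fun σ => (pinnedChain ω₂ lam β γ).bondCurrentZ σ 0) -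
        fun σ => max (-M) (min M ((pinnedChain ω₂ lam β γ).bondCurrentZ σ 0))) 2 Z.μ :=
      (Z.memLp_of_mem hjZ).sub (Z.memLp_of_mem haZ)
    obtain ⟨hsum, hle⟩ := hK _ hrd hrm hr2
    have hnorm : ‖Z.currentClass - Z.fluct (fun σ => max (-M) (min M ((pinnedChain ω₂ lam β γ).bondCurrentZ σ 0)))‖ ^ 2 =
        ∑' w : ℤ, cov[((fun σ => (pinnedChain ω₂ lam β γ).bondCurrentZ σ 0) -
          fun σ => max (-M) (min M ((pinnedChain ω₂ lam β γ).bondCurrentZ σ 0))),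
          (((fun σ => (pinnedChain ω₂ lam β γ).bondCurrentZ σ 0) -
            fun σ => max (-M) (min M ((pinnedChain ω₂ lam β γ).bondCurrentZ σ 0))) ∘ chainShift w); Z.μ] := by
      rw [Z.currentClass_def, ← FluctuationStructure.fluct_sub hjZ haZ, FluctuationStructure.norm_fluct_sq hrZ]
      exact Z.form_eq_tsum hrZ hrZ
    have hpt : ∀ σ : ChainConfig, ((fun σ => (pinnedChain ω₂ lam β γ).bondCurrentZ σ 0) -
        fun σ => max (-M) (min M ((pinnedChain ω₂ lam β γ).bondCurrentZ σ 0))) σ ^ 2 ≤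
        (pinnedChain ω₂ lam β γ).bondCurrentZ σ 0 ^ 4 / M ^ 2 := by
      intro σ
      have h1 := AbelThermodynamicLimit.LoomisCompactHorizonWitness.abs_sub_clamp_le_sq_div hM
        ((pinnedChain ω₂ lam β γ).bondCurrentZ σ 0)
      have h2 : 0 ≤ (pinnedChain ω₂ lam β γ).bondCurrentZ σ 0 ^ 2 / M := by positivity
      rw [Pi.sub_apply, ← sq_abs]
      calc |(pinnedChain ω₂ lam β γ).bondCurrentZ σ 0 - max (-M) (min M ((pinnedChain ω₂ lam β γ).bondCurrentZ σ 0))| ^ 2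
          ≤ ((pinnedChain ω₂ lam β γ).bondCurrentZ σ 0 ^ 2 / M) ^ 2 := pow_le_pow_left₀ (abs_nonneg _) h1 2
        _ = (pinnedChain ω₂ lam β γ).bondCurrentZ σ 0 ^ 4 / M ^ 2 := by ring
    have hint : ∫ σ, ((fun σ => (pinnedChain ω₂ lam β γ).bondCurrentZ σ 0) -
        fun σ => max (-M) (min M ((pinnedChain ω₂ lam β γ).bondCurrentZ σ 0))) σ ^ 2 ∂Z.μ ≤
        (∫ σ, (pinnedChain ω₂ lam β γ).bondCurrentZ σ 0 ^ 4 ∂Z.μ) / M ^ 2 := by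
      rw [← integral_div]
      exact integral_mono ((memLp_two_iff_integrable_sq hr2.aestronglyMeasurable).1 hr2) (hj4.div_const _) hpt
    calc ‖Z.currentClass - Z.fluct (fun σ => max (-M) (min M ((pinnedChain ω₂ lam β γ).bondCurrentZ σ 0)))‖ ^ 2
        = ∑' w : ℤ, cov[((fun σ => (pinnedChain ω₂ lam β γ).bondCurrentZ σ 0) -
            fun σ => max (-M) (min M ((pinnedChain ω₂ lam β γ).bondCurrentZ σ 0))),
            (((fun σ => (pinnedChain ω₂ lam β γ).bondCurrentZ σ 0) -
              fun σ => max (-M) (min M ((pinnedChain ω₂ lam β γ).bondCurrentZ σ 0))) ∘ chainShift w); Z.μ] := hnorm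
      _ ≤ ∑' w : ℤ, |cov[((fun σ => (pinnedChain ω₂ lam β γ).bondCurrentZ σ 0) -
            fun σ => max (-M) (min M ((pinnedChain ω₂ lam β γ).bondCurrentZ σ 0))),
            (((fun σ => (pinnedChain ω₂ lam β γ).bondCurrentZ σ 0) -
              fun σ => max (-M) (min M ((pinnedChain ω₂ lam β γ).bondCurrentZ σ 0))) ∘ chainShift w); Z.μ]| :=
          (Z.summable_cov hrZ hrZ).tsum_le_tsum (fun w => le_abs_self _) hsum
      _ ≤ K * ∫ σ, ((fun σ => (pinnedChain ω₂ lam β γ).bondCurrentZ σ 0) -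
            fun σ => max (-M) (min M ((pinnedChain ω₂ lam β γ).bondCurrentZ σ 0))) σ ^ 2 ∂Z.μ := hle
      _ ≤ K * ((∫ σ, (pinnedChain ω₂ lam β γ).bondCurrentZ σ 0 ^ 4 ∂Z.μ) / M ^ 2) :=
          mul_le_mul_of_nonneg_left hint hK0
      _ = K * (∫ σ, (pinnedChain ω₂ lam β γ).bondCurrentZ σ 0 ^ 4 ∂Z.μ) / M ^ 2 := (mul_div_assoc _ _ _).symm
  · refine hd.congr fun τ => ?_
    congr 1
    exact intervalIntegral.integral_congr fun t _ => Z.inner_currentClass_koopman_eq_currentCorrelation hmean t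

end Summit.AtomisticToContinuum.FouriersLaw.Theorems.NonBallistic.DrudeFromTruncation

namespace Summit.AtomisticToContinuum.FouriersLaw.Theorems.NonBallistic

open MeasureTheory ProbabilityTheory Filter Topology
open scoped NNReal ENNReal BigOperators
open Literature.MathematicalPhysics.KineticTheory
open Literature.MathematicalPhysics.KineticTheory.HeatConduction
open Summit.AtomisticToContinuum.FouriersLaw.Theorems.NonBallistic.DrudeFromTruncation

/-- **Stub `stub_drudeFromTruncationRegular`** (DFT′, registered stub 16 of line `drude-controls-conductance`,
R3b; harmonic-true): `CurrentTiltQuench.DrudeFromTruncation` (stmt-AtomisticToContinuum-11032) restricted to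
REGULAR dynamics (`D.carrier ⊆ 𝒳₀`). For the pinned anharmonic chain, a shift-invariant reversal-invariant
DLR state `μ` at `T > 0` and a `μ`-preserving dynamics with carrier in Buttà–Marchioro's good set, the
vanishing of all truncated Drude weights (the `NoTruncatedDrude` body) implies zero Drude weight,
`τ⁻¹∫₀^τ C_∞(t) dt → 0`: Doyon's `ℋ₀` with the clipped current as a local observable, the `L → ∞`
exchange at fixed `τ`, von Neumann's mean ergodic theorem (`ℙ[clip_M j₀] = 0`), and
`‖[j₀] - [clip_M j₀]‖₀² = O(M⁻²)` by `ρ`-mixing. [folklore] -/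
theorem stub_drudeFromTruncationRegular :
    ∀ ω₂ lam β γ : ℝ, 0 < ω₂ → 0 < lam → 0 < β → ∀ T : ℝ, 0 < T →
      ∀ μ : Measure ChainConfig, (pinnedChain ω₂ lam β γ).IsChainGibbsMeasure T μ → IsShiftInvariant μ →
        μ.map (fun σ : ChainConfig => fun x : ℤ => ((σ x).1, -(σ x).2)) = μ →
        ∀ D : InfiniteChainDynamics (pinnedChain ω₂ lam β γ), D.carrier ⊆ (pinnedChain ω₂ lam β γ).bmGood →
          D.PreservesMeasure μ →
          (∀ t : ℝ, ∀ᵐ σ ∂μ, D.flow t (shift σ) = shift (D.flow t σ)) →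
          (∀ t : ℝ, D.HasAbsConvergentCorrelation μ t) →
          (∀ M : ℝ, 0 < M → ∀ F : ℝ → ℝ, F = (fun u : ℝ => max (-M) (min M u)) → ∀ η : ℝ, 0 < η →
            ∃ τ₀ : ℝ, ∀ τ : ℝ, τ₀ ≤ τ → ∃ L₀ : ℕ, ∀ L : ℕ, L₀ ≤ L →
              ∀ G : ChainConfig → ℝ,
                G = (fun σ : ChainConfig => ∑ x ∈ Finset.Icc (-(L : ℤ)) (L : ℤ), F ((pinnedChain ω₂ lam β γ).bondCurrentZ σ x)) →
                |(τ⁻¹ * ∫ t in (0:ℝ)..τ, ((∫ σ, F ((pinnedChain ω₂ lam β γ).bondCurrentZ (D.flow t σ) 0) * G σ ∂μ) -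
                  (∫ σ, F ((pinnedChain ω₂ lam β γ).bondCurrentZ (D.flow t σ) 0) ∂μ) * (∫ σ, G σ ∂μ)))| ≤ η) →
          Tendsto (fun τ : ℝ => τ⁻¹ * ∫ t in (0:ℝ)..τ, D.currentCorrelation μ t) atTop (𝓝 0) := by
  intro ω₂ lam β γ hω hl hβ T hT μ hG hS hR D hsub hD _ _ hH
  -- the chain data
  have hU1 : OscillatorChain.IsEvenPolyOfDegree (pinnedChain ω₂ lam β γ).U 2 :=
    OscillatorChain.pinnedChain_isEvenPolyOfDegree_U β γ hω.le hl
  have hV1 : OscillatorChain.IsEvenPolyOfDegree (pinnedChain ω₂ lam β γ).V 2 :=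
    OscillatorChain.pinnedChain_isEvenPolyOfDegree_V ω₂ lam γ hβ
  have hUm : Measurable (pinnedChain ω₂ lam β γ).U := hU1.contDiff_two.continuous.measurable
  have hVm : Measurable (pinnedChain ω₂ lam β γ).V := hV1.contDiff_two.continuous.measurable
  have hss : (pinnedChain ω₂ lam β γ).HasSuperstabilityEstimate μ :=
    OscillatorChain.hasSuperstabilityEstimate_of_isShiftInvariant_pinnedChain γ hω hl.le hβ.le hT hG hS
  -- the Buttà–Marchioro dynamics and its normal form `D'`
  obtain ⟨Dbm, hcar_bm, -, -, -, -, -, hpres⟩ :=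
    OscillatorChain.exists_bmDynamics (P := pinnedChain ω₂ lam β γ) (by norm_num) (by norm_num) hU1 hV1
  have hDbm : Dbm.PreservesMeasure μ := hpres T μ hG hss
  obtain ⟨D', hcar', hon', hid, hD', -, -⟩ := Dbm.exists_normalForm_bmGood hUm hVm hcar_bm hDbm
  -- `D.flow t = D'.flow t` `μ`-a.e. (uniqueness of solutions inside `𝒳₀`)
  have hae : ∀ t : ℝ, ∀ᵐ σ ∂μ, D.flow t σ = D'.flow t σ := by
    intro t
    filter_upwards [hD.1] with σ hσ
    have horb : ∀ u : ℝ, D.flow u σ ∈ Dbm.carrier := fun u => by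
      rw [hcar_bm]; exact hsub (D.flow_mem hσ u)
    have h1 : D.flow t σ = Dbm.flow t σ := by
      have h := Dbm.unique (fun u => D.flow u σ) horb (D.isSolution σ hσ) t
      simpa only [D.flow_zero σ hσ] using h
    rw [h1, hon' t σ (hsub hσ)]
  have hcorr : ∀ t : ℝ, D.currentCorrelation μ t = D'.currentCorrelation μ t := fun t => by
    unfold InfiniteChainDynamics.currentCorrelation
    refine tsum_congr fun x => integral_congr_ae ?_
    filter_upwards [hae t] with σ hσ
    rw [hσ]
  -- the hypothesis for `D'`
  have hH' : ∀ M : ℝ, 0 < M → ∀ η : ℝ, 0 < η → ∃ τ₀ : ℝ, ∀ τ : ℝ, τ₀ ≤ τ → ∃ L₀ : ℕ, ∀ L : ℕ, L₀ ≤ L →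
      |τ⁻¹ * ∫ t in (0:ℝ)..τ,
        ((∫ σ, max (-M) (min M ((pinnedChain ω₂ lam β γ).bondCurrentZ (D'.flow t σ) 0)) *
            (∑ x ∈ Finset.Icc (-(L : ℤ)) (L : ℤ),
              max (-M) (min M ((pinnedChain ω₂ lam β γ).bondCurrentZ σ x))) ∂μ) -
          (∫ σ, max (-M) (min M ((pinnedChain ω₂ lam β γ).bondCurrentZ (D'.flow t σ) 0)) ∂μ) *
            (∫ σ, ∑ x ∈ Finset.Icc (-(L : ℤ)) (L : ℤ),
              max (-M) (min M ((pinnedChain ω₂ lam β γ).bondCurrentZ σ x)) ∂μ))| ≤ η := by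
    intro M hM η hη
    obtain ⟨τ₀, hτ₀⟩ := hH M hM _ rfl η hη
    refine ⟨τ₀, fun τ hτ => ?_⟩
    obtain ⟨L₀, hL₀⟩ := hτ₀ τ hτ
    refine ⟨L₀, fun L hL => ?_⟩
    have h := hL₀ L hL _ rfl
    have e1 : ∀ t : ℝ, (∫ σ, max (-M) (min M ((pinnedChain ω₂ lam β γ).bondCurrentZ (D'.flow t σ) 0)) *
        (∑ x ∈ Finset.Icc (-(L : ℤ)) (L : ℤ), max (-M) (min M ((pinnedChain ω₂ lam β γ).bondCurrentZ σ x))) ∂μ) =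
        ∫ σ, max (-M) (min M ((pinnedChain ω₂ lam β γ).bondCurrentZ (D.flow t σ) 0)) *
          (∑ x ∈ Finset.Icc (-(L : ℤ)) (L : ℤ), max (-M) (min M ((pinnedChain ω₂ lam β γ).bondCurrentZ σ x))) ∂μ :=
      fun t => integral_congr_ae (by filter_upwards [hae t] with σ hσ; rw [hσ])
    have e2 : ∀ t : ℝ, (∫ σ, max (-M) (min M ((pinnedChain ω₂ lam β γ).bondCurrentZ (D'.flow t σ) 0)) ∂μ) =
        ∫ σ, max (-M) (min M ((pinnedChain ω₂ lam β γ).bondCurrentZ (D.flow t σ) 0)) ∂μ :=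
      fun t => integral_congr_ae (by filter_upwards [hae t] with σ hσ; rw [hσ])
    simp only [e1, e2]
    simpa only using h
  -- the Cesàro limit of `C_∞` exists and is `≤ K E / M²` for every `M > 0`, hence it is `0`
  obtain ⟨K, E, hKE⟩ := exists_cesaro_currentCorrelation_limit_le γ hω hl hβ hT hG hS hR D' hcar' hid hD' hH'
  simp only [hcorr]
  obtain ⟨d₁, hd₁0, -, hd₁⟩ := hKE 1 one_pos
  have hdM : ∀ M : ℝ, 0 < M → d₁ ≤ K * E / M ^ 2 := fun M hM => by
    obtain ⟨d, -, hdle, hd⟩ := hKE M hM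
    rw [tendsto_nhds_unique hd₁ hd]
    exact hdle
  have hlim : Tendsto (fun M : ℝ => K * E / M ^ 2) atTop (𝓝 0) :=
    (tendsto_const_nhds (x := K * E)).div_atTop (tendsto_pow_atTop (by norm_num))
  have hd₁z : d₁ ≤ 0 := ge_of_tendsto hlim (eventually_atTop.2 ⟨1, fun M hM => hdM M (by linarith)⟩)
  have hz : d₁ = 0 := le_antisymm hd₁z hd₁0
  rw [hz] at hd₁
  exact hd₁

end Summit.AtomisticToContinuum.FouriersLaw.Theorems.NonBallistic

end
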